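import Literature.NumberTheory.EllipticCurves.LocalIndexBadPoints
import HarnessLib

/-!
# The local index for type `III*`: `c_v = 2` (proof)

Discharge of the named fact
`Literature.NumberTheory.EllipticCurves.localTamagawaNumber_eq_two_of_kodairaSymbolAt_eq_IIIstar`
(`NeronComponentIndex.lean`; Silverman, *ATAEC*, IV.9.4 Step 9, PDF p. 346: "If `π⁴ ∤ a₄`, then
Type III*, `m = 8`, `f = v(Δ) − 7`, `c = 2`"), by the elementary tools of
`LocalIndexBadPoints.lean` — the same argument as for type `III`
(`NeronComponentIndexTypeIIIProofs.lean`), three levels deeper.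

## Proof

Let `R` be a Henselian discrete valuation ring with perfect residue field and `I` an equation
over `R` with `Δ ≠ 0` on which Tate's algorithm stops at Step 9.

1. *Normal form* (`exists_smul_of_kodairaSymbolOfMinimal_eq_IIIstar`): after the translations of
   Steps 2, 6, 8, 9 (`TateAlgorithmTranslationsProofs`) the model `J = D • I` has `π ∣ a₁`,
   `π² ∣ a₂`, `π³ ∣ a₃`, `π³ ∣ a₄`, `π⁴ ∤ a₄`, `π⁵ ∣ a₆`; write `a₄ = π³δ`, `δ ∈ Rˣ`.
2. *Bad points* of `J` are integral points in `𝔪 × 𝔪`, hence (`dvd_of_equation_deep`) of the form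
   `(π²x', π³y')`; for two of them `N = x₁² + x₁x₂ + x₂² + a₂(x₁ + x₂) + a₄ − a₁y₂ = π³(δ + π·(…))`
   and `π³ ∣ D = y₁ + y₂ + a₁x₁ + a₃`, so their sum lies in `E₀(K)`
   (`hasNonsingularReduction_add_of_slope` with `e = 3`).
3. *A bad point exists*: `(π²t, 0)` with `t` a root of `πt³ + (a₂/π)t² + δt + a₆/π⁵` (Hensel).
4. Hence the index is `2` for `J`, so for `I` (`index_nonsingularReductionSubgroup_smul`), and
   `c_v = 2` at a place `v` (`O_v` is Henselian).

## References

* J. H. Silverman, *Advanced Topics in the Arithmetic of Elliptic Curves*, GTM 151, Springer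
  1994, IV.9.4 Step 9 (PDF p. 346) and its proof (PDF pp. 353–354). [SilvermanATAEC1994]
-/

noncomputable section

open scoped Classical

open IsLocalRing

namespace Literature.NumberTheory.EllipticCurves

namespace LocalIndex

open DiophantineGeometry DiophantineGeometry.TateAlgorithm

variable {R : Type*} [CommRing R] [IsDomain R] [IsDiscreteValuationRing R]

/-! ### Step 9 fired: the normal form -/

/-- Tate's tree returns `III*` exactly when the first eight tests fail and the ninth fires.
[folklore] -/
theorem tateTree_eq_IIIstar_iff (p1 p2 p3 p4 p5 p6 p7 p8 p9 p10 : Prop) [Decidable p1]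
    [Decidable p2] [Decidable p3] [Decidable p4] [Decidable p5] [Decidable p6] [Decidable p7]
    [Decidable p8] [Decidable p9] [Decidable p10] (n m : ℕ) :
    (if p1 then KodairaSymbol.I 0 else if p2 then .I n else if p3 then .II else if p4 then .III
      else if p5 then .IV else if p6 then .Istar 0 else if p7 then .Istar m
      else if p8 then .IVstar else if p9 then .IIIstar else if p10 then .IIstar else .I 0) =
        .IIIstar ↔ ¬ p1 ∧ ¬ p2 ∧ ¬ p3 ∧ ¬ p4 ∧ ¬ p5 ∧ ¬ p6 ∧ ¬ p7 ∧ ¬ p8 ∧ p9 := by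
  split_ifs <;> simp [*]

/-- **Step 9 fired.** `kodairaSymbolOfMinimal V = III*` iff the tests of Steps 1–8 fail on the
successive normalised models and `π⁴ ∤ a₄` on the Step-9 model. [folklore] -/
theorem kodairaSymbolOfMinimal_eq_IIIstar_iff (V : WeierstrassCurve R) :
    V.kodairaSymbolOfMinimal = .IIIstar ↔
      ¬ V.Δ ∉ maximalIdeal R ∧ ¬ (normalizeStep2 V).b₂ ∉ maximalIdeal R ∧
      ¬ (normalizeStep2 V).a₆ ∉ maximalIdeal R ^ 2 ∧
      ¬ (normalizeStep2 V).b₈ ∉ maximalIdeal R ^ 3 ∧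
      ¬ (normalizeStep2 V).b₆ ∉ maximalIdeal R ^ 3 ∧
      ¬ distinctRootCount (cubicStep6 (normalizeStep6 (normalizeStep2 V))) = 3 ∧
      ¬ distinctRootCount (cubicStep6 (normalizeStep6 (normalizeStep2 V))) = 2 ∧
      ¬ distinctRootCount
          (quadraticStep8 (normalizeStep8 (normalizeStep6 (normalizeStep2 V)))) = 2 ∧
      (normalizeStep9 (normalizeStep8 (normalizeStep6 (normalizeStep2 V)))).a₄ ∉
          maximalIdeal R ^ 4 := by
  unfold WeierstrassCurve.kodairaSymbolOfMinimal
  exact tateTree_eq_IIIstar_iff _ _ _ _ _ _ _ _ _ _ _ _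

/-- **The normal form of type `III*`.** Over a perfect residue field, if Tate's algorithm returns
`III*` then some `R`-model `D • V` has `π ∣ a₁`, `π² ∣ a₂`, `π³ ∣ a₃`, `π³ ∣ a₄`, `π⁴ ∤ a₄`,
`π⁵ ∣ a₆` (the translations of Steps 2, 6, 8, 9 exist; Silverman, *ATAEC*, IV.9.4 Steps 6–9,
PDF pp. 344–346). [cite: SilvermanATAEC1994, IV.9.4 Steps 6–9] -/
theorem exists_smul_of_kodairaSymbolOfMinimal_eq_IIIstar [PerfectField (ResidueField R)]
    (V : WeierstrassCurve R) (hV : V.kodairaSymbolOfMinimal = .IIIstar) :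
    ∃ D : WeierstrassCurve.VariableChange R,
      (D • V).a₁ ∈ maximalIdeal R ∧ (D • V).a₂ ∈ maximalIdeal R ^ 2 ∧
      (D • V).a₃ ∈ maximalIdeal R ^ 3 ∧ (D • V).a₄ ∈ maximalIdeal R ^ 3 ∧
      (D • V).a₄ ∉ maximalIdeal R ^ 4 ∧ (D • V).a₆ ∈ maximalIdeal R ^ 5 := by
  obtain ⟨h1, h2, h3, h4, h5, h6t, h7t, h8t, h9t⟩ :=
    (kodairaSymbolOfMinimal_eq_IIIstar_iff V).mp hV
  rw [not_not] at h1 h2 h3 h4 h5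
  -- Step 2
  have hex2 := exists_variableChange_step2_of_perfectField V h1
  have hN2 : normalizeStep2 V = hex2.choose • V := dif_pos hex2
  obtain ⟨-, hA₃, hA₄, -⟩ := hex2.choose_spec
  rw [hN2] at h2 h3 h4 h5 h6t h7t h8t h9t
  -- Step 6
  have hex6 := exists_variableChange_step6_of_perfectField h2 hA₃ hA₄ h3 h5 h4
  have hN6 : normalizeStep6 (hex2.choose • V) = hex6.choose • (hex2.choose • V) := dif_pos hex6
  obtain ⟨-, hB₁, hB₂, hB₃, hB₄, hB₆⟩ := hex6.choose_spec
  rw [hN6] at h6t h7t h8t h9t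
  -- Step 8
  have hex8 := exists_variableChange_step8_of_perfectField hB₁ hB₂ hB₃ hB₄ hB₆ h6t h7t
  have hN8 : normalizeStep8 (hex6.choose • (hex2.choose • V)) =
      hex8.choose • (hex6.choose • (hex2.choose • V)) := dif_pos hex8
  obtain ⟨-, hD₁, hD₂, hD₃, hD₄, hD₆⟩ := hex8.choose_spec
  rw [hN8] at h8t h9t
  -- Step 9
  have hex9 := exists_variableChange_step9_of_perfectField hD₁ hD₂ hD₃ hD₄ hD₆ h8t
  have hN9 : normalizeStep9 (hex8.choose • (hex6.choose • (hex2.choose • V))) =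
      hex9.choose • (hex8.choose • (hex6.choose • (hex2.choose • V))) := dif_pos hex9
  obtain ⟨-, hE₁, hE₂, hE₃, hE₄, hE₆⟩ := hex9.choose_spec
  rw [hN9] at h9t
  refine ⟨hex9.choose * hex8.choose * hex6.choose * hex2.choose, ?_⟩
  simp only [mul_smul]
  exact ⟨hE₁, hE₂, hE₃, hE₄, h9t, hE₆⟩

/-! ### The index for the normal form -/

variable {K : Type*} [Field K] [Algebra R K] [IsFractionRing R K]

/-- **`[E(K) : E₀(K)] = 2` for the normal form of type `III*`** over a Henselian discrete
valuation ring: the bad points are integral points `(π²x', π³y')` (`dvd_of_equation_deep`), any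
two of them add up into `E₀(K)` (`hasNonsingularReduction_add_of_slope`, `e = 3`), and `(π²t, 0)`
is a bad point for a Hensel root `t` of `πt³ + (a₂/π)t² + (a₄/π³)t + a₆/π⁵`.
[cite: SilvermanATAEC1994, IV.9.4 Step 9] -/
theorem index_eq_two_of_normalForm_IIIstar [HenselianLocalRing R] (J : WeierstrassCurve R)
    (hΔ : J.Δ ≠ 0) (h1 : J.a₁ ∈ maximalIdeal R) (h2 : J.a₂ ∈ maximalIdeal R ^ 2)
    (h3 : J.a₃ ∈ maximalIdeal R ^ 3) (h4 : J.a₄ ∈ maximalIdeal R ^ 3)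
    (h4' : J.a₄ ∉ maximalIdeal R ^ 4) (h6 : J.a₆ ∈ maximalIdeal R ^ 5) :
    (J.nonsingularReductionSubgroup (integers_valuationRing_valuation R K)).index = 2 := by
  have hϖ : Irreducible (uniformizer R) := irreducible_uniformizer
  set ϖ := uniformizer R with hϖdef
  have hinj := IsFractionRing.injective R K
  have h2' : J.a₂ ∈ maximalIdeal R := Ideal.pow_le_self two_ne_zero h2
  have h3' : J.a₃ ∈ maximalIdeal R := Ideal.pow_le_self three_ne_zero h3
  have h4'' : J.a₄ ∈ maximalIdeal R := Ideal.pow_le_self three_ne_zero h4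
  have h6' : J.a₆ ∈ maximalIdeal R := Ideal.pow_le_self (by norm_num) h6
  -- parameters: `a₁ = ϖα`, `a₂ = ϖ²β`, `a₃ = ϖ³γ`, `a₄ = ϖ³δ` (`δ` a unit), `a₆ = ϖ⁵ε`
  obtain ⟨α, hα⟩ := mem_maximalIdeal_iff_dvd.mp h1
  obtain ⟨β, hβ⟩ := mem_maximalIdeal_pow_iff_dvd.mp h2
  obtain ⟨γ, hγ⟩ := mem_maximalIdeal_pow_iff_dvd.mp h3
  obtain ⟨δ, hδ⟩ := mem_maximalIdeal_pow_iff_dvd.mp h4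
  have hδu : IsUnit δ := by
    refine IsLocalRing.notMem_maximalIdeal.mp fun hm => h4' ?_
    rw [mem_maximalIdeal_pow_iff_dvd, hδ, pow_succ]
    exact mul_dvd_mul_left _ (mem_maximalIdeal_iff_dvd.mp hm)
  obtain ⟨ε, hε⟩ := mem_maximalIdeal_pow_iff_dvd.mp h6
  have hΔK : (J.baseChange K).Δ ≠ 0 := by
    rw [WeierstrassCurve.baseChange, WeierstrassCurve.map_Δ]; exact (map_ne_zero_iff _ hinj).mpr hΔ
  -- (a) the sum of two bad points is good
  have hadd : ∀ P Q : (J.baseChange K).toAffine.Point, ¬ J.HasNonsingularReduction P →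
      ¬ J.HasNonsingularReduction Q → J.HasNonsingularReduction (P + Q) := by
    intro P Q hP hQ
    obtain ⟨x₁, y₁, hP₁, rfl, hx₁, hy₁⟩ :=
      exists_eq_some_of_not_hasNonsingularReduction J h3' h4'' h6' hP
    obtain ⟨x₂, y₂, hP₂, rfl, hx₂, hy₂⟩ :=
      exists_eq_some_of_not_hasNonsingularReduction J h3' h4'' h6' hQ
    have he₁ : J.toAffine.Equation x₁ y₁ :=
      (WeierstrassCurve.Affine.map_equation _ hinj _ _).mp hP₁.left
    have he₂ : J.toAffine.Equation x₂ y₂ :=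
      (WeierstrassCurve.Affine.map_equation _ hinj _ _).mp hP₂.left
    -- deep descent: `x = ϖ² a`, `y = ϖ³ c`
    obtain ⟨⟨a, rfl⟩, ⟨c₁, rfl⟩⟩ := dvd_of_equation_deep hϖ ⟨α, hα⟩ ⟨β, hβ⟩ ⟨γ, hγ⟩ ⟨δ, hδ⟩
      ⟨ε, hε⟩ he₁ (mem_maximalIdeal_iff_dvd.mp hx₁) (mem_maximalIdeal_iff_dvd.mp hy₁)
    obtain ⟨⟨b, rfl⟩, ⟨c, rfl⟩⟩ := dvd_of_equation_deep hϖ ⟨α, hα⟩ ⟨β, hβ⟩ ⟨γ, hγ⟩ ⟨δ, hδ⟩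
      ⟨ε, hε⟩ he₂ (mem_maximalIdeal_iff_dvd.mp hx₂) (mem_maximalIdeal_iff_dvd.mp hy₂)
    refine hasNonsingularReduction_add_of_slope J hϖ 3 h1 h2' h3' h4'' h6' hx₁ hx₂
      (isUnit_add_mul_of_isUnit hϖ hδu (a ^ 2 + a * b + b ^ 2 + β * (a + b) - α * c))
      ?_ ?_ hP₁ hP₂
    · rw [hδ, hβ, hα]; ring
    · rw [hα, hγ]; exact ⟨c₁ + c + α * a + γ, by ring⟩
  -- (b) a bad point `(ϖ² t, 0)`
  obtain ⟨t, ht⟩ := exists_root_of_henselian (ε := ε) (mem_maximalIdeal_iff_dvd.mpr (dvd_refl ϖ))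
    (Ideal.mul_mem_right β _ (mem_maximalIdeal_iff_dvd.mpr (dvd_refl ϖ))) hδu
  have heq : (J.baseChange K).toAffine.Equation (algebraMap R K (ϖ ^ 2 * t))
      (algebraMap R K 0) := by
    refine (WeierstrassCurve.Affine.map_equation _ hinj _ _).mpr ?_
    rw [WeierstrassCurve.Affine.equation_iff, hβ, hδ, hε]
    linear_combination (-(ϖ ^ 5)) * ht
  have hns : (J.baseChange K).toAffine.Nonsingular (algebraMap R K (ϖ ^ 2 * t))
      (algebraMap R K 0) :=
    (WeierstrassCurve.Affine.equation_iff_nonsingular_of_Δ_ne_zero hΔK).mp heq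
  have hbad : ¬ J.HasNonsingularReduction (.some _ _ hns) :=
    not_hasNonsingularReduction_some J h3' h4'' (Ideal.mul_mem_right _ _
      (Ideal.pow_mem_of_mem _ (mem_maximalIdeal_iff_dvd.mpr (dvd_refl ϖ)) 2 two_pos))
      (Ideal.zero_mem _) hns
  -- (c) index two
  refine index_eq_two_of_forall_add_mem _ (P₀ := .some _ _ hns) ?_ fun P Q hP hQ => ?_
  · rwa [WeierstrassCurve.mem_nonsingularReductionSubgroup_iff]
  · rw [WeierstrassCurve.mem_nonsingularReductionSubgroup_iff] at hP hQ ⊢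
    exact hadd P Q hP hQ

/-- **`[E(K) : E₀(K)] = 2` for type `III*`** over a Henselian discrete valuation ring with perfect
residue field (Silverman, *ATAEC*, IV.9.4 Step 9: `c = 2`), for an equation `I` with `Δ ≠ 0`.
[cite: SilvermanATAEC1994, IV.9.4 Step 9] -/
theorem index_eq_two_of_kodairaSymbolOfMinimal_eq_IIIstar [HenselianLocalRing R]
    [PerfectField (ResidueField R)] (I : WeierstrassCurve R) (hΔ : I.Δ ≠ 0)
    (hI : I.kodairaSymbolOfMinimal = .IIIstar) :
    (I.nonsingularReductionSubgroup (integers_valuationRing_valuation R K)).index = 2 := by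
  obtain ⟨D, h1, h2, h3, h4, h4', h6⟩ := exists_smul_of_kodairaSymbolOfMinimal_eq_IIIstar I hI
  rw [← index_nonsingularReductionSubgroup_smul I D]
  refine index_eq_two_of_normalForm_IIIstar (D • I) ?_ h1 h2 h3 h4 h4' h6
  rw [WeierstrassCurve.variableChange_Δ]
  exact mul_ne_zero (pow_ne_zero _ (Units.ne_zero _)) hΔ

end LocalIndex

/-! ### The discharge -/

section Discharge

open IsDedekindDomain

variable {A : Type*} [CommRing A] [IsDedekindDomain A] {K : Type*} [Field K] [Algebra A K]
  [IsFractionRing A K] (v : HeightOneSpectrum A) (W : WeierstrassCurve K)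

/-- **Discharge of `localTamagawaNumber_eq_two_of_kodairaSymbolAt_eq_IIIstar`**: `c_v = 2` for
type `III*` (Silverman, *ATAEC*, IV.9.4 Step 9, PDF p. 346), by the elementary argument of this
file over the Henselian ring `O_v`. [cite: SilvermanATAEC1994, IV.9.4 Step 9 (PDF p. 346)] -/
theorem localTamagawaNumber_eq_two_of_kodairaSymbolAt_eq_IIIstar_holds :
    localTamagawaNumber_eq_two_of_kodairaSymbolAt_eq_IIIstar v W := by
  intro _ _ hk
  rw [WeierstrassCurve.kodairaSymbolAt_def] at hk
  haveI := W.isElliptic_localMinimalModel v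
  change ((W.localMinimalModel v).goodReductionSubgroup (v.adicCompletionIntegers K)).index = 2
  have key : ∀ (M : WeierstrassCurve (v.adicCompletion K))
      [M.IsMinimal (v.adicCompletionIntegers K)] [M.IsElliptic],
      (M.integralModel (v.adicCompletionIntegers K)).kodairaSymbolOfMinimal = .IIIstar →
        (M.goodReductionSubgroup (v.adicCompletionIntegers K)).index = 2 := by
    intro M _ _ hM
    obtain ⟨I, rfl⟩ : ∃ I : WeierstrassCurve (v.adicCompletionIntegers K),
        M = I.baseChange (v.adicCompletion K) := WeierstrassCurve.IsIntegral.integral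
    rw [WeierstrassCurve.integralModel_baseChange_eq] at hM
    rw [WeierstrassCurve.goodReductionSubgroup_baseChange_eq]
    refine LocalIndex.index_eq_two_of_kodairaSymbolOfMinimal_eq_IIIstar I ?_ hM
    intro h0
    apply (I.baseChange (v.adicCompletion K)).Δ'.ne_zero
    rw [WeierstrassCurve.coe_Δ', WeierstrassCurve.baseChange, WeierstrassCurve.map_Δ, h0, map_zero]
  exact key (W.localMinimalModel v) hk

end Discharge

end Literature.NumberTheory.EllipticCurves

end
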